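import Literature.MathematicalPhysics.KineticTheory.HardSphereEulerProofs
import Literature.Analysis.FluidPDE.HardSphereFlowJointMeasurable
import Summits.AtomisticToContinuum.HydrodynamicLimit.Theorems.OneFlightGossipEngineCollisionActivityTailsNearFieldKineticMeasurable
import Summits.AtomisticToContinuum.HydrodynamicLimit.Theorems.OneFlightGossipEngineCollisionActivityTailsEndpointKinematics
import Summits.AtomisticToContinuum.HydrodynamicLimit.Theorems.OneFlightGossipEngineCollisionActivityTailsActivityDomination
import HarnessLib

/-!
# `CollisionActivityTails` (stmt-AtomisticToContinuum-13734), line `SketchK1`: near-field statics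

Helper file (`--supports stmt-AtomisticToContinuum-13734`) for the crux
`Summit.AtomisticToContinuum.HydrodynamicLimit.Theses.OneFlightGossipEngine.CollisionActivityTails`
(shared with `…Theses.TwoClocks.CollisionActivityTails`), skeleton line `SketchK1`, registered stub
`stub_nearFieldStatics` (statement `NearFieldStatics`). File 1 of 3 of the reduction of the line's
near-field kinetic tail statement `NearFieldKineticTails` (stub 5) to quadratic-velocity uniform
integrability plus an in-probability tagged-sphere window law of large numbers
(`…NearFieldKineticTailsPathwise`, `…NearFieldKineticTails`).

This file is the STATIC part, at one configuration `y` of the hard-sphere domain of diameter `ε`: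

* the scalar tail / fraction functionals `tailFn V y = 𝟙{V < y} y`, `fracFn V y = 𝟙{V < y}` and the
  truncation `𝟙{V < y} y ≤ 𝟙{M < y} y + M 𝟙{V < y}` (`tailFn_le_tailFn_add_mul_fracFn`);
* the quadratic velocity tail `kinTail M v = |v|² 𝟙{M < |v|}` (the integrand of
  `JParityClosure.KineticEnergyTails`) and the FAST near-field relative kinetic energy
  `relKineticFast y i r L = Σ_{j ≠ i, dist ≤ r} 𝟙{L < |v_j − v_i|²} |v_j − v_i|²`;
* **a fast relative velocity needs a fast partner**:
  `𝟙{4M² < |a − b|²}|a − b|² ≤ 4 |a|² 𝟙{M < |a|} + 4 |b|² 𝟙{M < |b|}` (`tailFn_normSq_sub_le`);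
* **truncation with packing** (`relKineticNear_le_add_fast`): at most `125` centres lie within `2ε`
  of a given centre (`…EndpointKinematics.card_near_le`), so
  `Σ_{near} |v_j − v_i|² ≤ 125 L + (fast part at level L)_i`;
* **double counting** (`sum_relKineticFast_le`): each centre is near at most `125` centres, so
  `Σ_i (fast part at level 4M²)_i ≤ 1000 Σ_i |v_i|² 𝟙{M < |v_i|}`.

The last two, at `L = 4M²`, are the registered statement `NearFieldStatics` (`stub_nearFieldStatics`).
The vocabulary (`Cfg`, `tdist`, `tailFn`, `relKineticNear`, …) is the line's, imported from
`…CollisionActivityTailsNearFieldKineticMeasurable` (same namespace); `fracFn`, `kinTail`,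
`relKineticFast` are verbatim copies of the skeleton's.

References: hard-core packing is folklore (at most `(2r/ε + 1)³` disjoint `ε`-balls with centres in
an `r`-ball); C. Cercignani, R. Illner, M. Pulvirenti, *The Mathematical Theory of Dilute Gases*
(1994), §4.2, for the hard-sphere phase space.
-/

noncomputable section

open MeasureTheory Set Filter Topology
open scoped ENNReal

namespace Summit.AtomisticToContinuum.HydrodynamicLimit.Theorems.CollisionActivityTailsNearFieldKineticTails

open Literature.MathematicalPhysics.KineticTheory Literature.Analysis.FluidPDE

/-! ## §1 Scalar lemmas: the tail and fraction functionals -/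

/-- The scalar FRACTION functional `y ↦ 𝟙{V < y}` (so `(N+1)⁻¹ Σ_i fracFn V (F²_i)` is the fraction of spheres
whose window average exceeds `V`). -/
def fracFn (V y : ℝ) : ℝ := Set.indicator {y : ℝ | V < y} (fun _ => (1 : ℝ)) y

/-- On the tail `V < y` the functional is the identity. -/
theorem tailFn_of_lt {V y : ℝ} (h : V < y) : tailFn V y = y :=
  Set.indicator_of_mem (show y ∈ {y : ℝ | V < y} from h) _

/-- Off the tail (`y ≤ V`) the functional vanishes. -/
theorem tailFn_of_le {V y : ℝ} (h : y ≤ V) : tailFn V y = 0 :=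
  Set.indicator_of_notMem (show y ∉ {y : ℝ | V < y} from fun h' => (not_lt.2 h) h') _

/-- The tail functional is nonnegative at nonnegative arguments. -/
theorem tailFn_nonneg {V y : ℝ} (hy : 0 ≤ y) : 0 ≤ tailFn V y :=
  Set.indicator_apply_nonneg fun _ => hy

/-- On the tail `V < y` the fraction functional is `1`. -/
theorem fracFn_of_lt {V y : ℝ} (h : V < y) : fracFn V y = 1 :=
  Set.indicator_of_mem (show y ∈ {y : ℝ | V < y} from h) _

/-- Off the tail (`y ≤ V`) the fraction functional vanishes. -/
theorem fracFn_of_le {V y : ℝ} (h : y ≤ V) : fracFn V y = 0 :=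
  Set.indicator_of_notMem (show y ∉ {y : ℝ | V < y} from fun h' => (not_lt.2 h) h') _

/-- The fraction functional is nonnegative. -/
theorem fracFn_nonneg (V y : ℝ) : 0 ≤ fracFn V y :=
  Set.indicator_apply_nonneg fun _ => zero_le_one

/-- `tailFn V` is measurable (indicator of the measurable set `{V < ·}` applied to the identity). -/
theorem measurable_tailFn (V : ℝ) : Measurable (tailFn V) :=
  measurable_id.indicator (measurableSet_lt measurable_const measurable_id)

/-- **Truncation.** `𝟙{V < y} y ≤ 𝟙{M < y} y + M 𝟙{V < y}` for `M, y ≥ 0`. -/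
theorem tailFn_le_tailFn_add_mul_fracFn {V M y : ℝ} (hM : 0 ≤ M) (hy : 0 ≤ y) :
    tailFn V y ≤ tailFn M y + M * fracFn V y := by
  by_cases hV : V < y
  · rw [tailFn_of_lt hV, fracFn_of_lt hV, mul_one]
    by_cases hMy : M < y
    · rw [tailFn_of_lt hMy]
      linarith
    · rw [tailFn_of_le (not_lt.1 hMy)]
      linarith [not_lt.1 hMy]
  · rw [tailFn_of_le (not_lt.1 hV)]
    exact add_nonneg (tailFn_nonneg hy) (mul_nonneg hM (fracFn_nonneg V y))

/-- Absorbing half the level: if `y ≤ M/2 + H` with `H ≥ 0` then `𝟙{M < y} y ≤ 2H`. -/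
theorem tailFn_le_two_mul {M y H : ℝ} (hH : 0 ≤ H) (h : y ≤ M / 2 + H) : tailFn M y ≤ 2 * H := by
  by_cases hMy : M < y
  · rw [tailFn_of_lt hMy]
    linarith
  · rw [tailFn_of_le (not_lt.1 hMy)]
    linarith

/-- `x ≤ L + 𝟙{L < x} x` for `L ≥ 0`. -/
theorem le_add_tailFn {L x : ℝ} (hL : 0 ≤ L) : x ≤ L + tailFn L x := by
  by_cases h : L < x
  · rw [tailFn_of_lt h]
    linarith
  · rw [tailFn_of_le (not_lt.1 h)]
    linarith [not_lt.1 h]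

/-! ## §2 Statics: the quadratic velocity tail and the fast near-field functional -/

/-- The quadratic velocity tail `v ↦ |v|² 𝟙{M < |v|}` (the integrand of `KineticEnergyTails`). -/
def kinTail (M : ℝ) (v : V3) : ℝ := Set.indicator {v : V3 | M < ‖v‖} (fun v => ‖v‖ ^ 2) v

/-- The quadratic velocity tail is nonnegative. -/
theorem kinTail_nonneg (M : ℝ) (v : V3) : 0 ≤ kinTail M v :=
  Set.indicator_apply_nonneg fun _ => sq_nonneg _

/-- Above the cut-off the quadratic velocity tail is `|v|²`. -/
theorem kinTail_of_lt {M : ℝ} {v : V3} (h : M < ‖v‖) : kinTail M v = ‖v‖ ^ 2 :=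
  Set.indicator_of_mem (show v ∈ {v : V3 | M < ‖v‖} from h) _

/-- The quadratic velocity tail is at most `|v|²`. -/
theorem kinTail_le_sq (M : ℝ) (v : V3) : kinTail M v ≤ ‖v‖ ^ 2 :=
  Set.indicator_apply_le' (fun _ => le_rfl) (fun _ => sq_nonneg _)

/-- The tail is antitone in the cut-off. -/
theorem kinTail_anti {M M' : ℝ} (h : M ≤ M') (v : V3) : kinTail M' v ≤ kinTail M v :=
  Set.indicator_le_indicator_of_subset (fun w (hw : M' < ‖w‖) => lt_of_le_of_lt h hw)
    (fun _ => sq_nonneg _) v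

/-- The quadratic velocity tail is measurable. -/
theorem measurable_kinTail (M : ℝ) : Measurable (kinTail M) :=
  (measurable_norm.pow_const 2).indicator (measurableSet_lt measurable_const measurable_norm)

/-- **Fast relative motion needs a fast partner.** `𝟙{4M² < |a − b|²}|a − b|² ≤ 4 |a|²𝟙{M<|a|} + 4 |b|²𝟙{M<|b|}`
(any real `M`): `|a − b| ≤ 2 max(|a|,|b|)`, so the larger of the two exceeds `M`, and `|a−b|² ≤ 4 max²`. -/
theorem tailFn_normSq_sub_le (M : ℝ) (a b : V3) :
    tailFn (4 * M ^ 2) (‖a - b‖ ^ 2) ≤ 4 * kinTail M a + 4 * kinTail M b := by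
  have ha0 := kinTail_nonneg M a
  have hb0 := kinTail_nonneg M b
  have hna := norm_nonneg a
  have hnb := norm_nonneg b
  by_cases h : 4 * M ^ 2 < ‖a - b‖ ^ 2
  · rw [tailFn_of_lt h]
    have hsq : ‖a - b‖ ^ 2 ≤ (‖a‖ + ‖b‖) ^ 2 := pow_le_pow_left₀ (norm_nonneg _) (norm_sub_le a b) 2
    rcases le_total ‖a‖ ‖b‖ with hab | hba
    · have hb : M < ‖b‖ := by
        by_contra hle
        push Not at hle
        have h2 : (‖a‖ + ‖b‖) ^ 2 ≤ (2 * M) ^ 2 :=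
          pow_le_pow_left₀ (by positivity) (by linarith) 2
        nlinarith
      rw [kinTail_of_lt hb]
      nlinarith [mul_nonneg (sub_nonneg.2 hab) (by positivity : (0 : ℝ) ≤ ‖a‖ + 3 * ‖b‖)]
    · have ha : M < ‖a‖ := by
        by_contra hle
        push Not at hle
        have h2 : (‖a‖ + ‖b‖) ^ 2 ≤ (2 * M) ^ 2 :=
          pow_le_pow_left₀ (by positivity) (by linarith) 2
        nlinarith
      rw [kinTail_of_lt ha]
      nlinarith [mul_nonneg (sub_nonneg.2 hba) (by positivity : (0 : ℝ) ≤ ‖b‖ + 3 * ‖a‖)]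
  · rw [tailFn_of_le (not_lt.1 h)]
    linarith

/-- The FAST near-field relative kinetic energy at `i`: `Σ_{j ≠ i, dist ≤ r} 𝟙{L < |v_j − v_i|²} |v_j − v_i|²`. -/
def relKineticFast {N : ℕ} (z : Cfg N) (i : Fin (N + 1)) (r L : ℝ) : ℝ :=
  ∑ j : Fin (N + 1), if j ≠ i ∧ tdist (z j).1 (z i).1 ≤ r then tailFn L (‖(z j).2 - (z i).2‖ ^ 2) else 0

/-- The near-field relative kinetic energy is nonnegative. -/
theorem relKineticNear_nonneg' {N : ℕ} (z : Cfg N) (i : Fin (N + 1)) (r : ℝ) : 0 ≤ relKineticNear z i r :=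
  Finset.sum_nonneg fun j _ => by split_ifs <;> positivity

/-- The fast near-field relative kinetic energy is nonnegative. -/
theorem relKineticFast_nonneg {N : ℕ} (z : Cfg N) (i : Fin (N + 1)) (r L : ℝ) : 0 ≤ relKineticFast z i r L :=
  Finset.sum_nonneg fun j _ => by
    split_ifs
    · exact tailFn_nonneg (sq_nonneg _)
    · exact le_rfl

/-- The fast part is at most the whole near-field relative kinetic energy. -/
theorem relKineticFast_le_relKineticNear {N : ℕ} (z : Cfg N) (i : Fin (N + 1)) (r L : ℝ) :
    relKineticFast z i r L ≤ relKineticNear z i r := by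
  unfold relKineticFast relKineticNear
  refine Finset.sum_le_sum fun j _ => ?_
  split_ifs
  · exact Set.indicator_apply_le' (fun _ => le_rfl) (fun _ => sq_nonneg _)
  · exact le_rfl

/-- The fast near-field relative kinetic energy at `i` is a measurable function of the configuration. -/
theorem measurable_relKineticFast {N : ℕ} (i : Fin (N + 1)) (r L : ℝ) :
    Measurable fun z : Cfg N => relKineticFast z i r L := by
  unfold relKineticFast
  refine Finset.measurable_sum _ fun j _ => Measurable.ite (measurableSet_near j i r) ?_ measurable_const
  exact (measurable_tailFn L).comp
    ((((measurable_pi_apply j).snd.sub (measurable_pi_apply i).snd).norm).pow_const 2)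

/-- Crude energy bound `Σ_{near} |v_j − v_i|² ≤ (4 + 4(N+1)) E` (from the landed `…ActivityDomination` copy). -/
theorem relKineticNear_le_energy' {N : ℕ} (y : Cfg N) (i : Fin (N + 1)) (r : ℝ) :
    relKineticNear y i r ≤ (4 + 4 * ((N : ℝ) + 1)) * configEnergy y :=
  CollisionActivityTailsActivityDomination.relKineticNear_le_energy y i r

/-- `tdist` is symmetric. -/
theorem tdist_comm' (x y : T3) : tdist x y = tdist y x := Torus.euclidDist_comm x y

/-- **Hard-core packing** (landed, `…EndpointKinematics.card_near_le`): in the hard-sphere domain of diameter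
`ε > 0` at most `125` centres lie within `2ε` of a given centre. -/
theorem card_near_le' {N : ℕ} {ε : ℝ} (hε : 0 < ε) {y : Cfg N}
    (hy : y ∈ hardSphereDomain (Torus.geometry (Fin 3)) (N + 1) ε) (i : Fin (N + 1)) :
    (Finset.univ.filter fun j : Fin (N + 1) => tdist (y j).1 (y i).1 ≤ 2 * ε).card ≤ 125 :=
  CollisionActivityTailsEndpointKinematics.card_near_le hε hy i

/-- **Static truncation with packing.** In the hard-sphere domain, `Σ_{near}|v_j − v_i|² ≤ 125 L + (fast part)`. -/
theorem relKineticNear_le_add_fast {N : ℕ} {ε : ℝ} (hε : 0 < ε) {y : Cfg N}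
    (hy : y ∈ hardSphereDomain (Torus.geometry (Fin 3)) (N + 1) ε) (i : Fin (N + 1)) {L : ℝ}
    (hL : 0 ≤ L) : relKineticNear y i (2 * ε) ≤ 125 * L + relKineticFast y i (2 * ε) L := by
  classical
  have hcard : (((Finset.univ.filter fun j : Fin (N + 1) => tdist (y j).1 (y i).1 ≤ 2 * ε).card : ℕ) : ℝ)
      ≤ 125 := by exact_mod_cast card_near_le' hε hy i
  have hterm : ∀ j : Fin (N + 1),
      (if j ≠ i ∧ tdist (y j).1 (y i).1 ≤ 2 * ε then ‖(y j).2 - (y i).2‖ ^ 2 else (0 : ℝ)) ≤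
        (if tdist (y j).1 (y i).1 ≤ 2 * ε then L else (0 : ℝ)) +
        (if j ≠ i ∧ tdist (y j).1 (y i).1 ≤ 2 * ε then tailFn L (‖(y j).2 - (y i).2‖ ^ 2) else (0 : ℝ)) := by
    intro j
    by_cases hn : tdist (y j).1 (y i).1 ≤ 2 * ε
    · by_cases hji : j ≠ i
      · rw [if_pos ⟨hji, hn⟩, if_pos hn, if_pos ⟨hji, hn⟩]
        exact le_add_tailFn hL
      · rw [if_neg (fun h => hji h.1), if_pos hn, if_neg (fun h => hji h.1)]
        linarith
    · rw [if_neg (fun h => hn h.2), if_neg hn, if_neg (fun h => hn h.2)]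
      simp
  unfold relKineticNear relKineticFast
  calc (∑ j, if j ≠ i ∧ tdist (y j).1 (y i).1 ≤ 2 * ε then ‖(y j).2 - (y i).2‖ ^ 2 else (0 : ℝ))
      ≤ ∑ j, ((if tdist (y j).1 (y i).1 ≤ 2 * ε then L else (0 : ℝ)) +
          (if j ≠ i ∧ tdist (y j).1 (y i).1 ≤ 2 * ε then tailFn L (‖(y j).2 - (y i).2‖ ^ 2) else (0 : ℝ))) :=
        Finset.sum_le_sum fun j _ => hterm j
    _ = (∑ j, if tdist (y j).1 (y i).1 ≤ 2 * ε then L else (0 : ℝ)) +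
          ∑ j, (if j ≠ i ∧ tdist (y j).1 (y i).1 ≤ 2 * ε then tailFn L (‖(y j).2 - (y i).2‖ ^ 2)
            else (0 : ℝ)) := Finset.sum_add_distrib
    _ ≤ 125 * L + ∑ j, (if j ≠ i ∧ tdist (y j).1 (y i).1 ≤ 2 * ε then tailFn L (‖(y j).2 - (y i).2‖ ^ 2)
            else (0 : ℝ)) := by
        have hsum : (∑ j, if tdist (y j).1 (y i).1 ≤ 2 * ε then L else (0 : ℝ)) =
            ((Finset.univ.filter fun j : Fin (N + 1) => tdist (y j).1 (y i).1 ≤ 2 * ε).card : ℝ) * L := by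
          rw [← Finset.sum_filter, Finset.sum_const, nsmul_eq_mul]
        rw [hsum]
        nlinarith

/-- **Double counting.** In the hard-sphere domain, `Σ_i (fast part at level 4M²)_i ≤ 1000 Σ_i |v_i|² 𝟙{M < |v_i|}`. -/
theorem sum_relKineticFast_le {N : ℕ} {ε : ℝ} (hε : 0 < ε) {y : Cfg N}
    (hy : y ∈ hardSphereDomain (Torus.geometry (Fin 3)) (N + 1) ε) (M : ℝ) :
    ∑ i, relKineticFast y i (2 * ε) (4 * M ^ 2) ≤ 1000 * ∑ i, kinTail M (y i).2 := by
  classical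
  have h1 : ∀ i : Fin (N + 1), relKineticFast y i (2 * ε) (4 * M ^ 2) ≤
      ∑ j, ((if tdist (y j).1 (y i).1 ≤ 2 * ε then 4 * kinTail M (y j).2 else (0 : ℝ)) +
            (if tdist (y j).1 (y i).1 ≤ 2 * ε then 4 * kinTail M (y i).2 else (0 : ℝ))) := by
    intro i
    unfold relKineticFast
    refine Finset.sum_le_sum fun j _ => ?_
    by_cases hn : tdist (y j).1 (y i).1 ≤ 2 * ε
    · rw [if_pos hn, if_pos hn]
      split_ifs
      · exact tailFn_normSq_sub_le M _ _
      · linarith [kinTail_nonneg M (y j).2, kinTail_nonneg M (y i).2]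
    · rw [if_neg (fun h => hn h.2), if_neg hn, if_neg hn, add_zero]
  have hA : ∀ i : Fin (N + 1),
      (∑ j, if tdist (y j).1 (y i).1 ≤ 2 * ε then 4 * kinTail M (y i).2 else (0 : ℝ)) ≤
        125 * (4 * kinTail M (y i).2) := by
    intro i
    rw [← Finset.sum_filter, Finset.sum_const, nsmul_eq_mul]
    have hc : (((Finset.univ.filter fun j : Fin (N + 1) => tdist (y j).1 (y i).1 ≤ 2 * ε).card : ℕ) : ℝ)
        ≤ 125 := by exact_mod_cast card_near_le' hε hy i
    exact mul_le_mul_of_nonneg_right hc (by linarith [kinTail_nonneg M (y i).2])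
  have hB : ∑ i, (∑ j, if tdist (y j).1 (y i).1 ≤ 2 * ε then 4 * kinTail M (y j).2 else (0 : ℝ)) ≤
      ∑ j, 125 * (4 * kinTail M (y j).2) := by
    rw [Finset.sum_comm]
    refine Finset.sum_le_sum fun j _ => ?_
    have hsymm : (∑ i, if tdist (y j).1 (y i).1 ≤ 2 * ε then 4 * kinTail M (y j).2 else (0 : ℝ)) =
        ∑ i, if tdist (y i).1 (y j).1 ≤ 2 * ε then 4 * kinTail M (y j).2 else (0 : ℝ) := by
      refine Finset.sum_congr rfl fun i _ => ?_
      rw [tdist_comm']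
    rw [hsymm, ← Finset.sum_filter, Finset.sum_const, nsmul_eq_mul]
    have hc : (((Finset.univ.filter fun i : Fin (N + 1) => tdist (y i).1 (y j).1 ≤ 2 * ε).card : ℕ) : ℝ)
        ≤ 125 := by exact_mod_cast card_near_le' hε hy j
    exact mul_le_mul_of_nonneg_right hc (by linarith [kinTail_nonneg M (y j).2])
  calc ∑ i, relKineticFast y i (2 * ε) (4 * M ^ 2)
      ≤ ∑ i, ∑ j, ((if tdist (y j).1 (y i).1 ≤ 2 * ε then 4 * kinTail M (y j).2 else (0 : ℝ)) +
            (if tdist (y j).1 (y i).1 ≤ 2 * ε then 4 * kinTail M (y i).2 else (0 : ℝ))) :=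
        Finset.sum_le_sum fun i _ => h1 i
    _ = ∑ i, (∑ j, if tdist (y j).1 (y i).1 ≤ 2 * ε then 4 * kinTail M (y j).2 else (0 : ℝ)) +
          ∑ i, (∑ j, if tdist (y j).1 (y i).1 ≤ 2 * ε then 4 * kinTail M (y i).2 else (0 : ℝ)) := by
        rw [← Finset.sum_add_distrib]
        exact Finset.sum_congr rfl fun i _ => Finset.sum_add_distrib
    _ ≤ ∑ j, 125 * (4 * kinTail M (y j).2) + ∑ i, 125 * (4 * kinTail M (y i).2) :=
        add_le_add hB (Finset.sum_le_sum fun i _ => hA i)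
    _ = 1000 * ∑ i, kinTail M (y i).2 := by
        rw [← Finset.sum_add_distrib, Finset.mul_sum]
        exact Finset.sum_congr rfl fun i _ => by ring

/-! ## §3 The registered statement -/

/-- **NEAR-FIELD STATICS** (stub 5e of line `SketchK1`; verbatim from the registered skeleton): hard-core packing at
radius `2ε` (≤ 125 centres) gives, in the hard-sphere domain, the truncation
`Σ_{near}|v_j − v_i|² ≤ 125·4M² + (fast part at level 4M²)_i` and the double-counting bound
`Σ_i (fast part)_i ≤ 1000 Σ_i |v_i|² 𝟙{M < |v_i|}` (a fast relative velocity needs a fast partner). -/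
def NearFieldStatics : Prop :=
  ∀ (N : ℕ) (ε : ℝ), 0 < ε → ∀ y : Cfg N, y ∈ hardSphereDomain (Torus.geometry (Fin 3)) (N + 1) ε →
    ∀ M : ℝ,
      (∀ i : Fin (N + 1), relKineticNear y i (2 * ε) ≤ 125 * (4 * M ^ 2) + relKineticFast y i (2 * ε) (4 * M ^ 2)) ∧
      ∑ i : Fin (N + 1), relKineticFast y i (2 * ε) (4 * M ^ 2) ≤ 1000 * ∑ i : Fin (N + 1), kinTail M (y i).2

/-- **STUB 5e (`stub_nearFieldStatics`, line `SketchK1`).** In the hard-sphere domain of diameter `ε > 0`, for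
every cut-off `M`: the truncation `Σ_{near}|v_j − v_i|² ≤ 125·4M² + (fast part at level 4M²)_i` at every sphere
(`relKineticNear_le_add_fast` with `L = 4M² ≥ 0`) and the double-counting bound
`Σ_i (fast part at level 4M²)_i ≤ 1000 Σ_i |v_i|² 𝟙{M < |v_i|}` (`sum_relKineticFast_le`). -/
theorem stub_nearFieldStatics : NearFieldStatics := fun _N _ε hε _y hy M =>
  ⟨fun i => relKineticNear_le_add_fast hε hy i (by positivity), sum_relKineticFast_le hε hy M⟩

end Summit.AtomisticToContinuum.HydrodynamicLimit.Theorems.CollisionActivityTailsNearFieldKineticTails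

end
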